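import Literature.MathematicalPhysics.QuantumFieldTheory.Balaban1983to89.B9GradViaDivLettersSmoothTerms

/-!
# `Balaban1983to89.B9GradViaDivLettersSmooth` — THE KINEMATIC LETTER `J_μ(U)` (sites → bonds) BETWEEN THE SMOOTH-PARTITION HÖLDER CLASSES (file 2 of 2: the
# `HasMaj` assembly): `HasMaj (bHZ ε p) (bHZK ε p) (J_μ(U)) (cR39·CJZ·e^{δ·rZ}·e^{−δd})` with a MEMBER-UNIFORM constant, under the certificate's contracting links, the
# ξ-scale small-gauge binder `hΘ` of `B9GradViaDivLettersAtPinsHolder` and the displayed enlargement radius of the (F1) adapters — the located «n06-l share» of the (F1) programme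

T. Bałaban, *Propagators for lattice gauge theories in a background field*, Commun. Math. Phys. **99** (1985) 389–434
[`Balaban1985BackgroundPropagators`, "B9"]; [4] = T. Bałaban, *Propagators and renormalization transformations for lattice gauge
theories. II*, Commun. Math. Phys. **96** (1984) 223–250 [`Balaban1984PropagatorsII`].

statement-level skeleton of published theorems with citation tags; proofs where landed; nothing here is a claim about the
Yang–Mills mass gap

THE PRINTED LOCI.  [B9] (3.3) p. 390, (3.35) p. 396, (3.40) p. 397, (3.43)–(3.45) p. 398 and the remark after (3.47) (*"λ replaced by a function J defined at bonds"*,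
*"invariant with respect to gauge transformations"*); [4] (2.51)–(2.54) p. 232, (2.137) p. 247.

WHY THIS FILE (cell `pub-ymgap`, node N06, seat dag-n06-l g20; with `B9GradViaDivLettersSmoothTerms`).  ★★ `hasMaj_JcoKH_smooth` —
`HasMaj (bHZ i hε0 hε1 hεp) (bHZK i hε0 hε1 hεp) (JcoKH i b B cfg μ U₁) (fun y y′ => cR39 b·CJZ ℓ p ϑ·e^{δ·rZ d ℓ r}·e^{−δ·d(y,y′)})`, `CJZ = L^{4p} + 2ϑL² + 2L + 1`,
`rZ = 2r + 2·rJ`, every `δ ≥ 0`, under: 1-faithful direction-blind `bI` (`hβ1`, `hbI0` — certificate binders), contracting links `hU`, `0 ≤ ε ≤ 1`, `ε ≤ p`, the ξ-scale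
small-gauge binder `hΘ : t^{−ε}·‖U_μ(s) − U_μ(s′)‖ ≤ ϑ` on admissible same-direction pairs (p620780's — it SUFFICES at the η-scale pair weight BECAUSE the sup weight is the
scale-covariant `(Lʲη)^{−p}`, `p ≥ ε`), and the displayed radius `hN : NearY i y z → d(y, sIK bI z) ≤ r` (n06-w6's LAYER B).  PROOF: the pair term, uniformly over near pairs,
is `≤ cR39·((2ϑL² + 2L)·W′S′ + H′)` (other directions vanish; direction `μ`: `abs_JcoKH_sub_le` = weight × transport variation (`hΘ`, `pow_weight_le_Wscl` at `|lev x − j(y′)| ≤ 2`)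
+ the shifted difference (`weight_mul_abs_sub_le` per coordinate, `supDist_shift` for the weight)); then EITHER something of `λ` is seen from `Δ̃(y)` — `dist_lvl_of_seen` gives
`d(y,y′) ≤ rZ` (pays `e^{δ rZ}`) and `W_y ≤ L^{4p}·W′` for the sup part (`abs_J_le_SupZ`) — OR nothing is, and the local size of `J_μλ` at `y` vanishes.
HONEST SCOPE.  Finite-dimensional bookkeeping; `hΘ` is a DISPLAYED gauge-variant binder (GAUGE-VARIANCE-MEMO: flat classes), `hN` a displayed radius; nothing of [B9]∕[4] asserted;
no pin of any certificate binder, no certificate edit; COUNT-NEUTRAL; N06 NOT discharged; nothing continuum, nothing about the mass gap.  Cell `pub-ymgap` (HUMAN RULING D-0062),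
Track A node N06 [B9], seat `pub-ymgap-dag-n06-l` (g20), 2026-08-28.
-/

noncomputable section

namespace Literature.MathematicalPhysics.QuantumFieldTheory.Balaban1983to89.B9GradViaDivLettersSmooth

open LatticeFieldCalculus (supDist)
open B4TorusKernel.MultiPeriod (torusSupNorm torusSupNorm_nonneg)
open B6MultiLevelTorusOperator (one_le_N0)
open B6Geom246MultiLevelBox (blkOf)
open B6Geom246MultiLevelTorus (geomT bondT)
open B6GlobalChartV1 (PV blkV1)
open B6Ineq2142KLevelV1 (β lvl)
open B6KLevelCensusIndexV1 (KIdx Adm tpar)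
open B6Prop22KLevelTorusCensusEta (nKT one_le_nKT one_le_torusSupNorm_sub)
open B9GeoNormsKLevelV1 (geo9K)
open B9Thm34Ext (toB6)
open B9Thm39ReadingCoords (cR39 cR39_nonneg coordBound39 basisBound39)
open B11SectG (BlockNorm HasMaj)
open B11SectGGlobal (Size)
open B11SectGGlobalSizes
open B9CoReadingCoords (XBK)
open B9CoReadingCoordsS (XSK sIK)
open B9GradViaDivLettersAtPins (JcoKH rJ)
open B9GradViaDivLettersAtPinsHolderPairs (torusSupNorm_chartY_sub tpar_eq abs_JcoKH_sub_le JcoKH_apply_of_dir_ne shift_injective')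
open B9MultiscaleSmoothPartitionY (scl scl_pos NearY levY_window_of_nearY)
open B9MultiscaleSmoothPartitionYLip (CLip)
open B9SmoothHolderClassS (bHZ bHZ_isLoc_iff Wscl Wscl_nonneg Wscl_mono NearPair wEta wEta_nonneg)
open B9SmoothHolderClassK (bHZK bHZK_loc srcY NearPairK wEtaK wEtaK_nonneg src_ne_of_nearPairK)
open B9GradViaDivLettersSmoothTerms
open Node00 (SiteY FBondY IBondY CfgY toKT levY)
open Node00.OpsYNablaBridge (chartY)

variable {𝔸 : Type} [NormedRing 𝔸] [NormedAlgebra ℂ 𝔸] [CompleteSpace 𝔸]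
variable {d ℓ : ℕ} {hd : 1 ≤ d + 1} {hL : Odd (ℓ + 1) ∧ 1 < ℓ + 1} {b₀ b₁ : ℝ}
variable (i : KIdx d ℓ hd hL b₀ b₁)
variable {κ : Type} [Fintype κ]

section Letter

variable [Fintype (geo9K i).Site]
variable (b : Module.Basis κ ℝ 𝔸) [FiniteDimensional ℝ 𝔸] (B : B9.Backgrounds) (cfg : B.Cfg → CfgY 𝔸 i)
variable {bI : FBondY i → IBondY i}

/-- ★★ **THE KINEMATIC LETTER `J_μ(U)` BETWEEN THE SMOOTH-PARTITION HÖLDER CLASSES** `bHZ ε p → bHZK ε p` (site → bond coordinate carrier), member-uniform constant: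
`HasMaj (bHZ i hε0 hε1 hεp) (bHZK i hε0 hε1 hεp) (J_μ(U₁)) (fun y y′ => cR39·CJZ ℓ p ϑ·e^{δ·rZ}·e^{−δ·d(y,y′)})`, every `δ ≥ 0`, under 1-faithful direction-blind `bI`,
contracting links, `0 ≤ ε ≤ 1`, `ε ≤ p`, the ξ-scale small-gauge binder `hΘ` (p620780's, gauge-VARIANT — displayed) and the displayed enlargement radius `hN` (LAYER B).
[cite: Balaban1985BackgroundPropagators, (3.3) p.390 + (3.35) p.396 + (3.40) p.397 + (3.43)–(3.45) p.398 + p.398 (remark after (3.47)); Balaban1984PropagatorsII, (2.51)–(2.54) p.232 + (2.137) p.247] -/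
theorem hasMaj_JcoKH_smooth {R : ℝ} {H : Prop} {ε p : ℝ} (hε0 : 0 ≤ ε) (hε1 : ε ≤ 1) (hεp : ε ≤ p)
    (hβ1 : ∀ f : FBondY i, (geomT i.D).dist (β i.hN i.D i.hk (bI f)) (blkV1 i.hN i.D f) ≤ 1)
    (hbI0 : ∀ f : FBondY i, bI f = bI ⟨f.src, 0⟩) {U₁ : B.Cfg}
    (hU : ∀ (ν : Fin (d + 1)) (s : Site (PV d ℓ i.m i.K hd hL) 0), ‖(cfg U₁ ν s : 𝔸)‖ ≤ 1 ∧ ‖(((cfg U₁ ν s)⁻¹ : 𝔸ˣ) : 𝔸)‖ ≤ 1)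
    {ϑ : ℝ} (hϑ : 0 ≤ ϑ)
    (hΘ : ∀ (μ : Fin (d + 1)) (s s' : Site (PV d ℓ i.m i.K hd hL) 0), Adm i ⟨s, μ⟩ ⟨s', μ⟩ →
      tpar i ⟨s, μ⟩ ⟨s', μ⟩ ^ (-ε) * ‖(cfg U₁ μ s : 𝔸) - (cfg U₁ μ s' : 𝔸)‖ ≤ ϑ)
    {r : ℝ} (hN : ∀ (y : IBondY i) (z : SiteY i), NearY i y z → (geo9K i).dist y (sIK i bI z) ≤ r) {δ : ℝ} (hδ : 0 ≤ δ) (μ : Fin (d + 1)) :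
    HasMaj (bHZ (κ := κ) i (R := R) (H := H) hε0 hε1 hεp) (bHZK (κ := κ) i (R := R) (H := H) hε0 hε1 hεp) (JcoKH i b B cfg μ U₁)
      (fun y y' => cR39 b * CJZ ℓ p ϑ * Real.exp (δ * rZ d ℓ r) * Real.exp (-(δ * (geo9K i).dist y y'))) := by
  classical
  intro y' lam hloc y
  rw [bHZ_isLoc_iff] at hloc
  set J := JcoKH i b B cfg μ U₁ with hJ
  set S : ℝ := SupZ (R := R) (H := H) i y' lam with hSdef
  set P : ℝ := PairZ (R := R) (H := H) i ε y' lam with hPdef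
  set W : ℝ := Wscl i p y' with hWdef
  have hp0 : 0 ≤ p := hε0.trans hεp
  have hL0 : (0 : ℝ) ≤ ((ℓ + 1 : ℕ) : ℝ) := Nat.cast_nonneg _
  have hL1 : (1 : ℝ) ≤ ((ℓ + 1 : ℕ) : ℝ) := by exact_mod_cast Nat.succ_le_succ (Nat.zero_le ℓ)
  have hS : 0 ≤ S := SupZ_nonneg (R := R) (H := H) (i := i) y' lam
  have hP : 0 ≤ P := PairZ_nonneg (R := R) (H := H) (ε := ε) (i := i) y' lam
  have hW : 0 ≤ W := Wscl_nonneg i p y'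
  have hcR := cR39_nonneg b
  have hcb : 0 ≤ coordBound39 b := norm_nonneg _
  have hbb : 0 ≤ basisBound39 b := Finset.sum_nonneg fun _ _ => norm_nonneg _
  have hloc' : (bHZ (κ := κ) i (R := R) (H := H) hε0 hε1 hεp).loc y' lam = W * S + P := bHZ_loc_eq hε0 hε1 hεp y' lam
  have hCJZ : 0 ≤ CJZ ℓ p ϑ := by unfold CJZ; positivity
  have hK0 : 0 ≤ cR39 b * CJZ ℓ p ϑ * Real.exp (δ * rZ d ℓ r) * Real.exp (-(δ * (geo9K i).dist y y')) := by positivity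
  rw [bHZK_loc, hloc']
  -- THE PAIR TERM, uniformly: `wEtaK·|Jλ q − Jλ q′| ≤ cR39·((2ϑL² + 2L)·W·S + P)` on near pairs
  have hpair : ∀ q q' : XBK κ i, NearPairK i q q' →
      wEtaK i ε q q' * |J lam q - J lam q'| ≤ cR39 b * ((2 * ϑ * (((ℓ + 1 : ℕ) : ℝ)) ^ 2 + 2 * ((ℓ + 1 : ℕ) : ℝ)) * (W * S) + P) := by
    intro q q' hqq
    obtain ⟨⟨x, dq⟩, s⟩ := q
    obtain ⟨⟨x', dq'⟩, s'⟩ := q'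
    have hbound0 : 0 ≤ cR39 b * ((2 * ϑ * (((ℓ + 1 : ℕ) : ℝ)) ^ 2 + 2 * ((ℓ + 1 : ℕ) : ℝ)) * (W * S) + P) := by positivity
    have hdir : dq = dq' := hqq.2.1.1
    by_cases hμ : dq = μ
    swap
    · -- other directions: both values vanish
      rw [JcoKH_apply_of_dir_ne i b B cfg μ U₁ lam (p := (⟨x, dq⟩, s)) hμ,
        JcoKH_apply_of_dir_ne i b B cfg μ U₁ lam (p := (⟨x', dq'⟩, s')) (by rw [← hdir]; exact hμ), sub_zero, abs_zero, mul_zero]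
      exact hbound0
    -- direction `μ`: `q = (⟨x,μ⟩, s)`, `q′ = (⟨x′,μ⟩, s)`
    cases hdir
    have hμ' : μ = dq := hμ.symm
    cases hμ'
    have hs : s = s' := hqq.2.2
    cases hs
    have hxne : x ≠ x' := src_ne_of_nearPairK i hqq
    have hadm : Adm i ⟨x, μ⟩ ⟨x', μ⟩ := hqq.2.1
    set z : SiteY i := chartY i (x.shift μ) with hz
    set z' : SiteY i := chartY i (x'.shift μ) with hz'
    have hzne : z.1 ≠ z'.1 := by
      intro he
      have : z = z' := Subtype.ext he
      exact hxne (shift_injective' i ((chartY i).injective this))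
    -- the weight of the bond pair IS the site weight of the shifted pair
    have hwz : wEtaK i ε (⟨x, μ⟩, s) (⟨x', μ⟩, s) = wEta i ε (z, s) (z', s) := by
      rw [wEtaK, wEta]
      show (((supDist x x' : ℝ) / (nKT (toKT i) : ℝ)) ^ ε)⁻¹ = _
      rw [← B6Grad2LegLettersKLevelV1.supDist_shift x x' μ, ← torusSupNorm_chartY_sub]
    -- the weight against `hΘ`: `wEtaK = t^{−ε}·((L^{lev x}∕Lᵏ)^ε)⁻¹`
    have hsd : (0 : ℝ) < (supDist x x' : ℝ) := by
      have h0 : supDist x x' ≠ 0 := fun h => hxne ((B3TorusRadialSums.supDist_eq_zero_iff x x').1 h)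
      exact_mod_cast Nat.pos_of_ne_zero h0
    have hn : (0 : ℝ) < (nKT (toKT i) : ℝ) := by exact_mod_cast lt_of_lt_of_le Nat.zero_lt_one (one_le_nKT (toKT i))
    have hlx : (blkV1 i.hN i.D (⟨x, μ⟩ : FBondY i)).1.1 = levY i (chartY i x) := blkV1_level_eq_levY i (⟨x, μ⟩, s)
    have hwt : wEtaK i ε (⟨x, μ⟩, s) (⟨x', μ⟩, s) =
        tpar i ⟨x, μ⟩ ⟨x', μ⟩ ^ (-ε) * (((((ℓ + 1 : ℕ) : ℝ)) ^ levY i (chartY i x) / (nKT (toKT i) : ℝ)) ^ ε)⁻¹ := by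
      rw [wEtaK, tpar_eq, hlx, Real.rpow_neg (by positivity), ← mul_inv, ← Real.mul_rpow (by positivity) (by positivity)]
      congr 2
      show (supDist x x' : ℝ) / (nKT (toKT i) : ℝ) = _
      field_simp
    -- the transport-variation term
    have htrans : wEtaK i ε (⟨x, μ⟩, s) (⟨x', μ⟩, s) *
        (2 * ‖(cfg U₁ μ x : 𝔸) - (cfg U₁ μ x' : 𝔸)‖ * (basisBound39 b * ∑ a, |lam (z, s.1, a, s.2.2)|)) ≤
        2 * ϑ * (((ℓ + 1 : ℕ) : ℝ)) ^ 2 * W * (basisBound39 b * ((Fintype.card κ : ℝ) * S)) := by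
      by_cases hsum : ∑ a, |lam (z, s.1, a, s.2.2)| = 0
      · rw [hsum, mul_zero, mul_zero, mul_zero]; positivity
      · -- some `λ(z, ·) ≠ 0`: `z ∈ Δ̃(y′)`, so `|lev x − j(y′)| ≤ 2`
        have hza : ∃ a, lam (z, s.1, a, s.2.2) ≠ 0 := by
          by_contra hall
          push Not at hall
          exact hsum (Finset.sum_eq_zero fun a _ => by rw [hall a, abs_zero])
        obtain ⟨a, ha⟩ := hza
        have hzN : NearY i y' z := by by_contra hn; exact ha (hloc (z, s.1, a, s.2.2) hn)
        have hlz := (levY_window_of_nearY i hzN).1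
        have hlxz := (levY_src_read i μ (⟨x, μ⟩, s)).2
        have hwle : (((((ℓ + 1 : ℕ) : ℝ)) ^ levY i (chartY i x) / (nKT (toKT i) : ℝ)) ^ ε)⁻¹ ≤ (((ℓ + 1 : ℕ) : ℝ)) ^ 2 * W :=
          pow_weight_le_Wscl i hε0 hε1 hεp (m := levY i (chartY i x)) (k := 2) (by
            have e1 : srcY i (⟨x, μ⟩, s) = chartY i x := rfl
            have e2 : readZ i μ (⟨x, μ⟩, s) = z := rfl
            rw [e1, e2] at hlxz
            omega)
        have hΘx := hΘ μ x x' hadm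
        have hsumle := sum_abs_le_card_SupZ (R := R) (H := H) hloc z s.1 s.2.2
        rw [hwt]
        have ht0 : 0 ≤ tpar i ⟨x, μ⟩ ⟨x', μ⟩ ^ (-ε) := Real.rpow_nonneg (B6KLevelCensusIndexV1.tpar_nonneg i _ _) _
        calc tpar i ⟨x, μ⟩ ⟨x', μ⟩ ^ (-ε) * (((((ℓ + 1 : ℕ) : ℝ)) ^ levY i (chartY i x) / (nKT (toKT i) : ℝ)) ^ ε)⁻¹ *
              (2 * ‖(cfg U₁ μ x : 𝔸) - (cfg U₁ μ x' : 𝔸)‖ * (basisBound39 b * ∑ a, |lam (z, s.1, a, s.2.2)|))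
            = 2 * (tpar i ⟨x, μ⟩ ⟨x', μ⟩ ^ (-ε) * ‖(cfg U₁ μ x : 𝔸) - (cfg U₁ μ x' : 𝔸)‖) *
                (((((ℓ + 1 : ℕ) : ℝ)) ^ levY i (chartY i x) / (nKT (toKT i) : ℝ)) ^ ε)⁻¹ * (basisBound39 b * ∑ a, |lam (z, s.1, a, s.2.2)|) := by ring
          _ ≤ 2 * ϑ * ((((ℓ + 1 : ℕ) : ℝ)) ^ 2 * W) * (basisBound39 b * ((Fintype.card κ : ℝ) * S)) := by
              refine mul_le_mul (mul_le_mul (mul_le_mul_of_nonneg_left hΘx (by norm_num)) hwle (by positivity) (by positivity))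
                (mul_le_mul_of_nonneg_left hsumle hbb) (by positivity) (by positivity)
          _ = _ := by ring
    -- the shifted-difference term
    have hdiff : wEtaK i ε (⟨x, μ⟩, s) (⟨x', μ⟩, s) * (basisBound39 b * ∑ a, |lam (z, s.1, a, s.2.2) - lam (z', s.1, a, s.2.2)|) ≤
        basisBound39 b * ((Fintype.card κ : ℝ) * (P + 2 * ((ℓ + 1 : ℕ) : ℝ) * (W * S))) := by
      rw [hwz, mul_left_comm, Finset.mul_sum]
      refine mul_le_mul_of_nonneg_left ?_ hbb
      calc ∑ a, wEta i ε (z, s) (z', s) * |lam (z, s.1, a, s.2.2) - lam (z', s.1, a, s.2.2)|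
          ≤ ∑ _a : κ, (P + 2 * ((ℓ + 1 : ℕ) : ℝ) * (W * S)) := Finset.sum_le_sum fun a _ => by
            have h := weight_mul_abs_sub_le (R := R) (H := H) hε0 hε1 hεp hloc hzne (s.1, a, s.2.2)
            have hw' : wEta i ε (z, s.1, a, s.2.2) (z', s.1, a, s.2.2) = wEta i ε (z, s) (z', s) := rfl
            rw [hw'] at h
            exact h
        _ = _ := by rw [Finset.sum_const, nsmul_eq_mul, Finset.card_univ]
    -- assemble the pair term
    have hJsub := abs_JcoKH_sub_le i b B cfg μ U₁ hU lam x x' s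
    have hw0 : 0 ≤ wEtaK i ε (⟨x, μ⟩, s) (⟨x', μ⟩, s) := wEtaK_nonneg i ε _ _
    calc wEtaK i ε (⟨x, μ⟩, s) (⟨x', μ⟩, s) * |J lam (⟨x, μ⟩, s) - J lam (⟨x', μ⟩, s)|
        ≤ wEtaK i ε (⟨x, μ⟩, s) (⟨x', μ⟩, s) * (coordBound39 b *
            (2 * ‖(cfg U₁ μ x : 𝔸) - (cfg U₁ μ x' : 𝔸)‖ * (basisBound39 b * ∑ a, |lam (z, s.1, a, s.2.2)|) +
              basisBound39 b * ∑ a, |lam (z, s.1, a, s.2.2) - lam (z', s.1, a, s.2.2)|)) := mul_le_mul_of_nonneg_left hJsub hw0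
      _ = coordBound39 b * (wEtaK i ε (⟨x, μ⟩, s) (⟨x', μ⟩, s) *
            (2 * ‖(cfg U₁ μ x : 𝔸) - (cfg U₁ μ x' : 𝔸)‖ * (basisBound39 b * ∑ a, |lam (z, s.1, a, s.2.2)|)) +
            wEtaK i ε (⟨x, μ⟩, s) (⟨x', μ⟩, s) * (basisBound39 b * ∑ a, |lam (z, s.1, a, s.2.2) - lam (z', s.1, a, s.2.2)|)) := by ring
      _ ≤ coordBound39 b * (2 * ϑ * (((ℓ + 1 : ℕ) : ℝ)) ^ 2 * W * (basisBound39 b * ((Fintype.card κ : ℝ) * S)) +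
            basisBound39 b * ((Fintype.card κ : ℝ) * (P + 2 * ((ℓ + 1 : ℕ) : ℝ) * (W * S)))) :=
          mul_le_mul_of_nonneg_left (add_le_add htrans hdiff) hcb
      _ = cR39 b * ((2 * ϑ * (((ℓ + 1 : ℕ) : ℝ)) ^ 2 + 2 * ((ℓ + 1 : ℕ) : ℝ)) * (W * S) + P) := by simp only [cR39]; ring
  -- THE CASE SPLIT: is anything seen from `Δ̃(y)`?
  by_cases hseen : ∃ q q' : XBK κ i, NearY i y (srcY i q) ∧ (q' = q ∨ NearPairK i q q') ∧ NearY i y' (readZ i μ q')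
  · obtain ⟨q₀, q₁, hq₀, hq₀₁, hq₁⟩ := hseen
    obtain ⟨hdist, hlvl⟩ := dist_lvl_of_seen i hβ1 hbI0 hN μ hq₀ hq₀₁ hq₁
    have hexp : 1 ≤ Real.exp (δ * rZ d ℓ r) * Real.exp (-(δ * (geo9K i).dist y y')) := by
      rw [← Real.exp_add]; exact Real.one_le_exp (by nlinarith)
    have hWy : Wscl i p y ≤ (((ℓ + 1 : ℕ) : ℝ)) ^ ((4 : ℝ) * p) * W := by
      have h := Wscl_le_of_lvl_le i hp0 (k := 4) hlvl
      simp only [Nat.cast_ofNat] at h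
      exact h
    -- sup part
    have hsup : Wscl i p y * (Size.ofSup (toB6 (geo9K i) R H) (fun (q : XBK κ i) (y : IBondY i) => NearY i y (srcY i q))).sz y (J lam) ≤
        (((ℓ + 1 : ℕ) : ℝ)) ^ ((4 : ℝ) * p) * cR39 b * (W * S) := by
      have h1 : (Size.ofSup (toB6 (geo9K i) R H) (fun (q : XBK κ i) (y : IBondY i) => NearY i y (srcY i q))).sz y (J lam) ≤ cR39 b * S :=
        ofSup_sz_le _ (mul_nonneg hcR hS) fun q _ => abs_J_le_SupZ (R := R) (H := H) μ U₁ hU hloc q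
      calc Wscl i p y * _ ≤ ((((ℓ + 1 : ℕ) : ℝ)) ^ ((4 : ℝ) * p) * W) * (cR39 b * S) := mul_le_mul hWy h1 (Size.nonneg _ _ _) (by positivity)
        _ = _ := by ring
    -- pair part
    have hprs : (Size.ofPairs (toB6 (geo9K i) R H) (fun (q : XBK κ i) (y : IBondY i) => NearY i y (srcY i q)) (NearPairK i) (wEtaK i ε)
          (wEtaK_nonneg i ε)).sz y (J lam) ≤ cR39 b * ((2 * ϑ * (((ℓ + 1 : ℕ) : ℝ)) ^ 2 + 2 * ((ℓ + 1 : ℕ) : ℝ)) * (W * S) + P) :=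
      ofPairs_sz_le _ _ _ _ (by positivity) fun q q' _ hqq => hpair q q' hqq
    calc _ ≤ (((ℓ + 1 : ℕ) : ℝ)) ^ ((4 : ℝ) * p) * cR39 b * (W * S) + cR39 b * ((2 * ϑ * (((ℓ + 1 : ℕ) : ℝ)) ^ 2 + 2 * ((ℓ + 1 : ℕ) : ℝ)) * (W * S) + P) :=
          add_le_add hsup hprs
      _ ≤ cR39 b * CJZ ℓ p ϑ * (W * S + P) := by
          unfold CJZ
          nlinarith [mul_nonneg hcR hP, mul_nonneg hcR (mul_nonneg hW hS), mul_nonneg (mul_nonneg hcR hϑ) hP,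
            mul_nonneg (mul_nonneg hcR (Real.rpow_nonneg hL0 ((4 : ℝ) * p))) hP, mul_nonneg hcR (mul_nonneg hL0 hP)]
      _ ≤ cR39 b * CJZ ℓ p ϑ * (Real.exp (δ * rZ d ℓ r) * Real.exp (-(δ * (geo9K i).dist y y'))) * (W * S + P) :=
          mul_le_mul_of_nonneg_right (le_mul_of_one_le_right (mul_nonneg hcR hCJZ) hexp) (by positivity)
      _ = _ := by ring
  · -- nothing of `λ` is seen from `Δ̃(y)`: the local size vanishes
    push Not at hseen
    have hval0 : ∀ q : XBK κ i, NearY i y (srcY i q) → J lam q = 0 := by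
      intro q hq
      by_contra hne
      exact hseen q q hq (Or.inl rfl) (nearY_read_of_J_ne_zero μ U₁ hU hloc hne)
    have hval0' : ∀ q q' : XBK κ i, NearY i y (srcY i q) → NearPairK i q q' → J lam q' = 0 := by
      intro q q' hq hqq
      by_contra hne
      exact hseen q q' hq (Or.inr hqq) (nearY_read_of_J_ne_zero μ U₁ hU hloc hne)
    have hsup : (Size.ofSup (toB6 (geo9K i) R H) (fun (q : XBK κ i) (y : IBondY i) => NearY i y (srcY i q))).sz y (J lam) ≤ 0 :=
      ofSup_sz_le _ le_rfl fun q hq => by rw [hval0 q hq, abs_zero]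
    have hprs : (Size.ofPairs (toB6 (geo9K i) R H) (fun (q : XBK κ i) (y : IBondY i) => NearY i y (srcY i q)) (NearPairK i) (wEtaK i ε)
          (wEtaK_nonneg i ε)).sz y (J lam) ≤ 0 :=
      ofPairs_sz_le _ _ _ _ le_rfl fun q q' hq hqq => by rw [hval0 q hq, hval0' q q' hq hqq, sub_zero, abs_zero, mul_zero]
    calc _ ≤ Wscl i p y * 0 + 0 := add_le_add (mul_le_mul_of_nonneg_left hsup (Wscl_nonneg i p y)) hprs
      _ = 0 := by ring
      _ ≤ _ := mul_nonneg hK0 (by positivity)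

end Letter

end Literature.MathematicalPhysics.QuantumFieldTheory.Balaban1983to89.B9GradViaDivLettersSmooth
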